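import Summits.QuantumFields.YangMills.Theorems.SwapVirialDeficitTauberSandwichLayerCake
import Summits.QuantumFields.YangMills.Theorems.SwapVirialDeficitSwapGluedStiffnessOfSharpSwapLaplace
import Summits.QuantumFields.YangMills.Theorems.SwapVirialDeficitSwapRingDeficit
import Summits.QuantumFields.YangMills.Theorems.VirialFluxGapSharpTwistedLaplaceWindowArithmetic
import Summits.QuantumFields.YangMills.Theorems.VirialFluxGapDeficitForm
import HarnessLib

/-!
# Route `SwapVirialDeficit` (YangMills): the heart of LINE «sharp-sigma» reduced to a SHARP SMALL-BALL LAW of the σ-glued ring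
# (crux ⟨stmt-QuantumFields-24197⟩ `SwapVirialDeficit.SwapGluedStiffness`: `SharpSwapVolumeLaw ⟹ SharpSwapLaplace ⟹ SwapGluedStiffness`)

The σ-glued ring trace is a mixture of eight sector Laplace transforms, ✓`SwapRing.twistTrace_eq_sum_exp_mul_integral_deficit`:
`Z^S(L,b,2L) = e^{12bL⁴}·I^S_L(b)`, `I^S_L(b) = ∫_{s>0} b e^{−bs} m^S_L(s) ds`, with the MIXED STATE DENSITY
`m^S_L(s) = (1/8)·Σ_z μ_L{F^S_z ≤ s}` of the σ-glued deficits.  Hence (§2) a sharp small-ball law for `m^S_L` — exponent `9L⁴ − 1` (no log),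
volume coefficient `v(L)` with `|log v(L)| ≤ K₁L^{q₁}`, power remainder `K₁L^{q₁}·t^θ` on `(0, (K₁L^{q₁})⁻¹]` — gives, by the layer-cake Tauberian
sandwich with power remainder ✓`tauber_sandwich_rpow_layerCake` on the Laplace window of ✓`VirialFluxGapSharpTwistedLaplaceWindow.stub_windowArithmetic`
(plus `10K₁L^{q₁+4}·b^{−θ} ≤ 1/4`, §1), the heart `SharpSwapLaplace` of LINE «sharp-sigma» with `K = 20K₁ + 2`, `q = q₁ + 4`, the same `θ`,
`C(L) = log v(L) + log (9L⁴−1)!`: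

★★ `sharpSwapLaplace_of_sharpSwapVolumeLaw`, and with ✓`swapGluedStiffness_of_sharpSwapLaplace`
★★★ `swapGluedStiffness_of_sharpSwapVolumeLaw : SharpSwapVolumeLaw → Theses.SwapVirialDeficit.SwapGluedStiffness` (BY NAME).

So on LINE g14-B both cruxes of ⟨24194⟩ rest on SHARP STATE-DENSITY LAWS of the same (uniform-in-`L`) type: ⟨24196⟩ on `ToronTubeVolumeLaw`
⟨24497⟩ (periodic ring, exponent `9L⁴ − 3/2`, one log) by ✓`toronSoftnessSharp_of_toronTubeVolumeLaw`, and ⟨24197⟩ on `SharpSwapVolumeLaw`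
(σ-glued ring, exponent `9L⁴ − 1`, no log; the cell's fixed-`L` two-sided rows ✓`SwapRingLogFreeFloor` / ✓`SigmaTwistedCeiling` /
✓`SwapRingSectors` confirm the exponent at every fixed `L`, constants `e^{O(L⁴ log L)}` apart).  `SharpSwapVolumeLaw` is stated INLINE as the
hypothesis `hVol` (no `def`; the planner may file it).  The remainder is a POWER `t^θ` (the σ zero-mode block has corrections `t^{1/4}`, LINE
card «sharp-sigma»), which is why ✓`tauber_sandwich` (`κ·t`) was re-proved with `κ·t^θ`.
HONEST FRAMING: conditional bookkeeping; `SharpSwapVolumeLaw`, the heart `SharpSwapLaplace`, ⟨24197⟩, ⟨24194⟩ and every rung / summit statement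
stay OPEN; the Yang–Mills mass gap is NOT proved; no summit is proved by a line.  THEOREMS ONLY (0 `def`, 0 `sorry`), standard axioms.
Seat ym-line-fcl-p3 g43 (cell ym-idea-1, free hands), `--supports stmt-QuantumFields-24197`.
References: [cite: Griffiths1964]; [cite: tHooft1979]; [cite: Luscher1983, §2]; [cite: MontvayMunster1994, (3.145)].
-/

set_option autoImplicit false

noncomputable section

namespace Summit.QuantumFields.YangMills.Theorems.SwapVirialDeficit.SharpSigma

open MeasureTheory Set Filter Real
open scoped Nat Topology BigOperators
open Summit.QuantumFields.YangMills.Theorems.TwistEaterVolume.Tauber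
open Summit.QuantumFields.YangMills.Theorems.FemtoTransferGap
open Summit.QuantumFields.YangMills.Theorems.VirialFluxGap.RingDeficit
open Summit.QuantumFields.YangMills.Theorems.SwapVirialDeficit.SwapRing
open Summit.QuantumFields.YangMills.Theorems.VirialFluxGapSharpTwistedLaplaceWindow (stub_windowArithmetic)

/-! ## §1 Window arithmetic for the power remainder -/

/-- On the window `L ≤ b^a`, `a·(q₁+4) ≤ θ/2`, `b ≥ (40K₁+1)^{2/θ}`, `b ≥ 1`: `10K₁·L^{q₁+4}·b^{−θ} ≤ 1/4`. [folklore] -/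
theorem remainder_window {K₁ q₁ θ a b : ℝ} {L : ℕ} (hK₁ : 0 < K₁) (hq₁ : 0 ≤ q₁) (hθ : 0 < θ) (haq : a * (q₁ + 4) ≤ θ / 2)
    (hb1 : 1 ≤ b) (hbB : (40 * K₁ + 1) ^ (2 / θ) ≤ b) (hLwin : (L : ℝ) ≤ b ^ a) :
    10 * K₁ * (L : ℝ) ^ (q₁ + 4) * b ^ (-θ) ≤ 1 / 4 := by
  have hb0 : 0 < b := by linarith
  have hL0 : (0 : ℝ) ≤ (L : ℝ) := Nat.cast_nonneg L
  -- `L^{q₁+4} ≤ b^{θ/2}`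
  have h1 : (L : ℝ) ^ (q₁ + 4) ≤ b ^ (θ / 2) := by
    calc (L : ℝ) ^ (q₁ + 4) ≤ (b ^ a) ^ (q₁ + 4) := Real.rpow_le_rpow hL0 hLwin (by linarith)
      _ = b ^ (a * (q₁ + 4)) := by rw [← Real.rpow_mul hb0.le]
      _ ≤ b ^ (θ / 2) := Real.rpow_le_rpow_of_exponent_le hb1 haq
  -- `b^{θ/2} ≥ 40K₁ + 1`
  have hB1 : (0 : ℝ) ≤ 40 * K₁ + 1 := by positivity
  have h2 : 40 * K₁ + 1 ≤ b ^ (θ / 2) := by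
    calc 40 * K₁ + 1 = ((40 * K₁ + 1) ^ (2 / θ)) ^ (θ / 2) := by
          rw [← Real.rpow_mul hB1, show 2 / θ * (θ / 2) = 1 by field_simp, Real.rpow_one]
      _ ≤ b ^ (θ / 2) := Real.rpow_le_rpow (Real.rpow_nonneg hB1 _) hbB (by positivity)
  have hbθ2 : 0 < b ^ (θ / 2) := Real.rpow_pos_of_pos hb0 _
  -- combine: `L^{q₁+4}·b^{−θ} ≤ b^{θ/2}·b^{−θ} = (b^{θ/2})⁻¹ ≤ (40K₁+1)⁻¹`
  have h3 : (L : ℝ) ^ (q₁ + 4) * b ^ (-θ) ≤ (40 * K₁ + 1)⁻¹ := by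
    have hprod : b ^ (θ / 2) * b ^ (-θ) = (b ^ (θ / 2))⁻¹ := by
      rw [← Real.rpow_add hb0, show θ / 2 + -θ = -(θ / 2) by ring, Real.rpow_neg hb0.le]
    calc (L : ℝ) ^ (q₁ + 4) * b ^ (-θ) ≤ b ^ (θ / 2) * b ^ (-θ) := mul_le_mul_of_nonneg_right h1 (Real.rpow_nonneg hb0.le _)
      _ = (b ^ (θ / 2))⁻¹ := hprod
      _ ≤ (40 * K₁ + 1)⁻¹ := inv_anti₀ (by positivity) h2
  have h4 : 10 * K₁ * (40 * K₁ + 1)⁻¹ ≤ 1 / 4 := by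
    rw [← div_eq_mul_inv, div_le_div_iff₀ (by positivity) (by norm_num)]
    nlinarith
  calc 10 * K₁ * (L : ℝ) ^ (q₁ + 4) * b ^ (-θ) = 10 * K₁ * ((L : ℝ) ^ (q₁ + 4) * b ^ (-θ)) := by ring
    _ ≤ 10 * K₁ * (40 * K₁ + 1)⁻¹ := mul_le_mul_of_nonneg_left h3 (by positivity)
    _ ≤ 1 / 4 := h4

/-! ## §2 The sharp σ-glued Laplace law from the sharp σ-glued small-ball law -/

/-- ★★ **`SharpSwapVolumeLaw ⟹ SharpSwapLaplace`**: a sharp small-ball law of the mixed σ-glued state density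
`(1/8)Σ_z μ_L{F^S_z ≤ t} = v(L)·t^{9L⁴−1}·(1 ± K₁L^{q₁}t^θ)` on `(0, (K₁L^{q₁})⁻¹]`, `|log v(L)| ≤ K₁L^{q₁}`, gives the sharp two-sided Laplace
law of the σ-glued ring trace on Laplace windows `L ≤ b^a` with `K = 20K₁ + 2`, `q = q₁ + 4`, `C(L) = log v(L) + log (9L⁴−1)!`.
[cite: Griffiths1964] [cite: tHooft1979] -/
theorem sharpSwapLaplace_of_sharpSwapVolumeLaw
    (hVol : ∃ K₁ : ℝ, 0 < K₁ ∧ ∃ q₁ : ℝ, 0 ≤ q₁ ∧ ∃ θ : ℝ, 0 < θ ∧ θ ≤ 1 ∧ ∃ v : ℕ → ℝ, ∃ L₀ : ℕ,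
      ∀ (L : ℕ) [NeZero L], L₀ ≤ L → 0 < v L ∧ |Real.log (v L)| ≤ K₁ * (L : ℝ) ^ q₁ ∧
        ∀ t : ℝ, 0 < t → t ≤ (K₁ * (L : ℝ) ^ q₁)⁻¹ →
          |((1 / 8 : ℝ) * ∑ z : Fin 3 → Bool, (ringMeasure L).real {P | swapRingDeficit L z P ≤ t}) / (v L * t ^ (9 * L ^ 4 - 1)) - 1| ≤
            K₁ * (L : ℝ) ^ q₁ * t ^ θ) :
    ∃ a : ℝ, 0 < a ∧ ∃ K : ℝ, 0 < K ∧ ∃ q : ℝ, 0 ≤ q ∧ ∃ θ : ℝ, 0 < θ ∧ θ ≤ 1 ∧ ∃ C : ℕ → ℝ, ∃ β₀ : ℝ, ∃ L₀ : ℕ,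
      ∀ b : ℝ, β₀ ≤ b → ∀ (L : ℕ) [NeZero L], L₀ ≤ L → (L : ℝ) ≤ b ^ a →
        |Real.log (TT.twistTrace L b (2 * L)) - (12 * b * (L : ℝ) ^ 4 - (9 * (L : ℝ) ^ 4 - 1) * Real.log b + C L)| ≤
          K * (L : ℝ) ^ q * b ^ (-θ) := by
  obtain ⟨K₁, hK₁, q₁, hq₁, θ, hθ, hθ1, v, L₀, hV⟩ := hVol
  obtain ⟨a₁, ha₁, β₁, hW⟩ := stub_windowArithmetic K₁ q₁ hK₁ hq₁
  have hq4 : 0 < q₁ + 4 := by linarith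
  set a : ℝ := min a₁ (θ / (2 * (q₁ + 4))) with ha
  have ha0 : 0 < a := lt_min ha₁ (by positivity)
  have haa₁ : a ≤ a₁ := min_le_left _ _
  have haq : a * (q₁ + 4) ≤ θ / 2 := by
    have h : a ≤ θ / (2 * (q₁ + 4)) := min_le_right _ _
    calc a * (q₁ + 4) ≤ θ / (2 * (q₁ + 4)) * (q₁ + 4) := mul_le_mul_of_nonneg_right h hq4.le
      _ = θ / 2 := by field_simp
  refine ⟨a, ha0, 20 * K₁ + 2, by positivity, q₁ + 4, by linarith, θ, hθ, hθ1,
    fun L => Real.log (v L) + Real.log ((9 * L ^ 4 - 1) ! : ℝ), max (max β₁ 4) ((40 * K₁ + 1) ^ (2 / θ)), max L₀ 1, ?_⟩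
  intro b hb L _ hL hLwin
  have hbβ₁ : β₁ ≤ b := le_trans (le_trans (le_max_left _ _) (le_max_left _ _)) hb
  have hb4 : 4 ≤ b := le_trans (le_trans (le_max_right _ _) (le_max_left _ _)) hb
  have hbB : (40 * K₁ + 1) ^ (2 / θ) ≤ b := le_trans (le_max_right _ _) hb
  have hb1 : 1 ≤ b := by linarith
  have hb0 : 0 < b := by linarith
  have hL₀ : L₀ ≤ L := le_trans (le_max_left _ _) hL
  have hL1 : 1 ≤ L := le_trans (le_max_right _ _) hL
  have hL1r : (1 : ℝ) ≤ (L : ℝ) := by exact_mod_cast hL1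
  have hL0 : (0 : ℝ) < (L : ℝ) := by linarith
  obtain ⟨hv, hlogv, hvol⟩ := hV L hL₀
  -- the window of `stub_windowArithmetic` (exponent `a₁ ≥ a`)
  have hLwin₁ : (L : ℝ) ≤ b ^ a₁ := hLwin.trans (Real.rpow_le_rpow_of_exponent_le hb1 haa₁)
  obtain ⟨_, _, hwin, _⟩ := hW b hbβ₁ L hL1 hLwin₁ (Real.log (v L)) hlogv
  -- constants
  set κ : ℝ := K₁ * (L : ℝ) ^ q₁ with hκ
  have hκ0 : 0 < κ := by positivity
  set t₀ : ℝ := κ⁻¹ with ht₀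
  have ht₀0 : 0 < t₀ := inv_pos.mpr hκ0
  set N : ℕ := 9 * L ^ 4 - 1 with hN
  have h9L : 1 ≤ 9 * L ^ 4 := by have := Nat.one_le_pow 4 L hL1; omega
  have hNr : (N : ℝ) = 9 * (L : ℝ) ^ 4 - 1 := by
    rw [hN, Nat.cast_sub h9L]; push_cast; ring
  have hL4 : (1 : ℝ) ≤ (L : ℝ) ^ 4 := one_le_pow₀ hL1r
  have hN2 : (N : ℝ) + 2 ≤ 10 * (L : ℝ) ^ 4 := by rw [hNr]; linarith
  have hN2' : (N : ℝ) + 2 ≤ ((9 * L ^ 4 : ℕ) : ℝ) + 2 := by rw [hNr]; push_cast; linarith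
  have hN20 : 0 ≤ (N : ℝ) + 2 := by positivity
  -- `κ(N+2) ≤ 10K₁L^{q₁+4}`
  have hLq4 : (L : ℝ) ^ q₁ * (L : ℝ) ^ 4 = (L : ℝ) ^ (q₁ + 4) := by
    rw [Real.rpow_add hL0, show ((L : ℝ) ^ (4 : ℝ)) = (L : ℝ) ^ (4 : ℕ) by exact_mod_cast Real.rpow_natCast (L : ℝ) 4]
  have hκN : κ * ((N : ℝ) + 2) ≤ 10 * K₁ * (L : ℝ) ^ (q₁ + 4) := by
    calc κ * ((N : ℝ) + 2) ≤ κ * (10 * (L : ℝ) ^ 4) := mul_le_mul_of_nonneg_left hN2 hκ0.le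
      _ = 10 * K₁ * ((L : ℝ) ^ q₁ * (L : ℝ) ^ 4) := by rw [hκ]; ring
      _ = 10 * K₁ * (L : ℝ) ^ (q₁ + 4) := by rw [hLq4]
  have hrem := remainder_window hK₁ hq₁ hθ haq hb1 hbB hLwin
  have hβκ : κ * ((N : ℝ) + 2) * b ^ (-θ) ≤ 1 / 4 :=
    (mul_le_mul_of_nonneg_right hκN (Real.rpow_nonneg hb0.le _)).trans hrem
  -- the window hypothesis of the sandwich for `N = 9L⁴ − 1` (from the landed one for `9L⁴`)
  have hS0 : 0 ≤ 1 + |Real.log (v L)| + |Real.log t₀| + Real.log b := by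
    have := Real.log_nonneg hb1; positivity
  have hwin' : 64 * ((N : ℝ) + 2) ^ 2 * (1 + |Real.log (v L)| + |Real.log t₀| + Real.log b) ≤ b * t₀ := by
    have hsq : ((N : ℝ) + 2) ^ 2 ≤ (((9 * L ^ 4 : ℕ) : ℝ) + 2) ^ 2 := pow_le_pow_left₀ hN20 hN2' 2
    calc 64 * ((N : ℝ) + 2) ^ 2 * (1 + |Real.log (v L)| + |Real.log t₀| + Real.log b)
        ≤ 64 * (((9 * L ^ 4 : ℕ) : ℝ) + 2) ^ 2 * (1 + |Real.log (v L)| + |Real.log t₀| + Real.log b) :=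
          mul_le_mul_of_nonneg_right (mul_le_mul_of_nonneg_left hsq (by norm_num)) hS0
      _ ≤ b * t₀ := by rw [ht₀, hκ]; exact hwin
  -- the mixed state density
  haveI := isProbabilityMeasure_ringMeasure (L := L)
  set μ := ringMeasure L with hμ
  set m : ℝ → ℝ := fun s => (1 / 8 : ℝ) * ∑ z : Fin 3 → Bool, μ.real {P | swapRingDeficit L z P ≤ s} with hm
  have hm0 : ∀ s, 0 ≤ m s := fun s => by
    rw [hm]; exact mul_nonneg (by norm_num) (Finset.sum_nonneg fun z _ => measureReal_nonneg)
  have hcard : (Finset.univ : Finset (Fin 3 → Bool)).card = 8 := by simp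
  have hm1 : ∀ s, m s ≤ 1 := fun s => by
    rw [hm]
    have h : ∑ z : Fin 3 → Bool, μ.real {P | swapRingDeficit L z P ≤ s} ≤ ∑ _z : Fin 3 → Bool, (1 : ℝ) :=
      Finset.sum_le_sum fun z _ => measureReal_le_one
    rw [Finset.sum_const, hcard] at h
    norm_num at h
    linarith
  have hvol' : ∀ t : ℝ, 0 < t → t ≤ t₀ → |m t / (v L * t ^ N) - 1| ≤ κ * t ^ θ := by
    intro t ht htle
    have h := hvol t ht (by rw [ht₀, hκ] at htle; exact htle)
    rw [hm, hN, hκ]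
    exact h
  -- integrability of the layer cake of `m` and its value
  have hF : ∀ z : Fin 3 → Bool, Measurable (swapRingDeficit L z) := fun z => measurable_swapRingDeficit z
  have hF0 : ∀ z : Fin 3 → Bool, ∀ P, 0 ≤ swapRingDeficit L z P := fun z P => swapRingDeficit_nonneg (L := L) z P
  have hint_z : ∀ z : Fin 3 → Bool, IntegrableOn (fun s : ℝ => (1 / 8 : ℝ) * (b * rexp (-(b * s)) * μ.real {P | swapRingDeficit L z P ≤ s}))
      (Ioi 0) := fun z => (integrableOn_mul_exp_neg_mul_mul_sublevel (μ := μ) (swapRingDeficit L z) hb0).const_mul _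
  have hsum_int : IntegrableOn (fun s : ℝ => ∑ z : Fin 3 → Bool, (1 / 8 : ℝ) * (b * rexp (-(b * s)) * μ.real {P | swapRingDeficit L z P ≤ s}))
      (Ioi 0) := integrable_finsetSum _ fun z _ => hint_z z
  have heq : EqOn (fun s : ℝ => ∑ z : Fin 3 → Bool, (1 / 8 : ℝ) * (b * rexp (-(b * s)) * μ.real {P | swapRingDeficit L z P ≤ s}))
      (fun s : ℝ => b * rexp (-(b * s)) * m s) (Ioi 0) := by
    intro s _
    simp only [hm, Finset.mul_sum]
    refine Finset.sum_congr rfl fun z _ => ?_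
    ring
  have hintgG : IntegrableOn (fun s : ℝ => b * rexp (-(b * s)) * m s) (Ioi 0) := hsum_int.congr_fun heq measurableSet_Ioi
  -- `I = (1/8) Σ_z ∫ e^{−bF_z} dμ`
  set I : ℝ := ∫ s in Ioi 0, b * rexp (-(b * s)) * m s with hI
  have hIeq : I = (1 / 8 : ℝ) * ∑ z : Fin 3 → Bool, ∫ P, rexp (-(b * swapRingDeficit L z P)) ∂μ := by
    rw [hI, ← setIntegral_congr_fun measurableSet_Ioi heq, integral_finsetSum _ fun z _ => hint_z z, Finset.mul_sum]
    refine Finset.sum_congr rfl fun z _ => ?_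
    rw [integral_const_mul, integral_exp_neg_mul_eq_integral_sublevel (μ := μ) (swapRingDeficit L z) (hF z) (hF0 z) hb0]
  -- `Z^S = e^{12bL⁴}·I`
  have hZ : TT.twistTrace L b (2 * L) = rexp (12 * b * (L : ℝ) ^ 4) * I := by
    rw [twistTrace_eq_sum_exp_mul_integral_deficit (L := L) b, hIeq, Finset.mul_sum, Finset.mul_sum, Finset.mul_sum]
    refine Finset.sum_congr rfl fun z _ => ?_
    ring
  have hZpos : 0 < TT.twistTrace L b (2 * L) :=
    ((Summit.QuantumFields.YangMills.Theorems.swapVirialDeficit_ringTraceSmooth_proof L (2 * L)).2.2 b).2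
  have hIpos : 0 < I := by
    rw [hZ] at hZpos
    exact pos_of_mul_pos_right hZpos (Real.exp_pos _).le
  have hlogZ : Real.log (TT.twistTrace L b (2 * L)) = 12 * b * (L : ℝ) ^ 4 + Real.log I := by
    rw [hZ, Real.log_mul (Real.exp_pos _).ne' hIpos.ne', Real.log_exp]
  -- the sandwich
  have hT := tauber_sandwich_rpow_layerCake m N (v L) κ θ t₀ hm0 hm1 hv ht₀0 hκ0.le hθ hθ1 hvol' hb4 hβκ hwin' hintgG
  -- packaging: `2κ(N+2)b^{−θ} + 2/b ≤ (20K₁+2)·L^{q₁+4}·b^{−θ}`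
  have hbθ : 1 / b ≤ b ^ (-θ) := by
    rw [one_div, ← Real.rpow_neg_one]
    exact Real.rpow_le_rpow_of_exponent_le hb1 (by linarith)
  have hLq1 : (1 : ℝ) ≤ (L : ℝ) ^ (q₁ + 4) := Real.one_le_rpow hL1r (by linarith)
  have hbθ0 : 0 ≤ b ^ (-θ) := Real.rpow_nonneg hb0.le _
  have hpack : 2 * κ * ((N : ℝ) + 2) * b ^ (-θ) + 2 / b ≤ (20 * K₁ + 2) * (L : ℝ) ^ (q₁ + 4) * b ^ (-θ) := by
    have h1 : 2 * κ * ((N : ℝ) + 2) * b ^ (-θ) ≤ 20 * K₁ * (L : ℝ) ^ (q₁ + 4) * b ^ (-θ) := by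
      have h := mul_le_mul_of_nonneg_right hκN hbθ0
      calc 2 * κ * ((N : ℝ) + 2) * b ^ (-θ) = 2 * (κ * ((N : ℝ) + 2) * b ^ (-θ)) := by ring
        _ ≤ 2 * (10 * K₁ * (L : ℝ) ^ (q₁ + 4) * b ^ (-θ)) := by linarith [h]
        _ = 20 * K₁ * (L : ℝ) ^ (q₁ + 4) * b ^ (-θ) := by ring
    have h2 : 2 / b ≤ 2 * (L : ℝ) ^ (q₁ + 4) * b ^ (-θ) := by
      calc 2 / b = 2 * (1 / b) := by ring
        _ ≤ 2 * b ^ (-θ) := by linarith [hbθ]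
        _ = 2 * 1 * b ^ (-θ) := by ring
        _ ≤ 2 * (L : ℝ) ^ (q₁ + 4) * b ^ (-θ) := mul_le_mul_of_nonneg_right (by linarith) hbθ0
    calc 2 * κ * ((N : ℝ) + 2) * b ^ (-θ) + 2 / b ≤ 20 * K₁ * (L : ℝ) ^ (q₁ + 4) * b ^ (-θ) + 2 * (L : ℝ) ^ (q₁ + 4) * b ^ (-θ) :=
          add_le_add h1 h2
      _ = (20 * K₁ + 2) * (L : ℝ) ^ (q₁ + 4) * b ^ (-θ) := by ring
  -- assemble
  have e : Real.log (TT.twistTrace L b (2 * L)) - (12 * b * (L : ℝ) ^ 4 - (9 * (L : ℝ) ^ 4 - 1) * Real.log b +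
        (Real.log (v L) + Real.log ((9 * L ^ 4 - 1) ! : ℝ))) =
      Real.log I - (Real.log (v L) + Real.log (N ! : ℝ) - N * Real.log b) := by
    rw [hlogZ, hNr]
    ring
  rw [e]
  exact hT.trans hpack

/-- ★★★ **`SharpSwapVolumeLaw ⟹ SwapGluedStiffness` BY NAME**: the sharp small-ball law of the mixed σ-glued state density (exponent `9L⁴ − 1`,
no log, power remainder, `|log v(L)| ≤ K₁L^{q₁}`) implies the route crux ⟨stmt-QuantumFields-24197⟩ (with `c = 1/4`), through
✓`sharpSwapLaplace_of_sharpSwapVolumeLaw` and ✓`swapGluedStiffness_of_sharpSwapLaplace`. [cite: Griffiths1964] [cite: tHooft1979] -/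
theorem swapGluedStiffness_of_sharpSwapVolumeLaw
    (hVol : ∃ K₁ : ℝ, 0 < K₁ ∧ ∃ q₁ : ℝ, 0 ≤ q₁ ∧ ∃ θ : ℝ, 0 < θ ∧ θ ≤ 1 ∧ ∃ v : ℕ → ℝ, ∃ L₀ : ℕ,
      ∀ (L : ℕ) [NeZero L], L₀ ≤ L → 0 < v L ∧ |Real.log (v L)| ≤ K₁ * (L : ℝ) ^ q₁ ∧
        ∀ t : ℝ, 0 < t → t ≤ (K₁ * (L : ℝ) ^ q₁)⁻¹ →
          |((1 / 8 : ℝ) * ∑ z : Fin 3 → Bool, (ringMeasure L).real {P | swapRingDeficit L z P ≤ t}) / (v L * t ^ (9 * L ^ 4 - 1)) - 1| ≤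
            K₁ * (L : ℝ) ^ q₁ * t ^ θ) :
    Summit.QuantumFields.YangMills.Theses.SwapVirialDeficit.SwapGluedStiffness :=
  swapGluedStiffness_of_sharpSwapLaplace (sharpSwapLaplace_of_sharpSwapVolumeLaw hVol)

end Summit.QuantumFields.YangMills.Theorems.SwapVirialDeficit.SharpSigma

end
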